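import Mathlib
import HarnessLib
import Literature.MathematicalPhysics.QuantumFieldTheory.ConstructiveQFTWave0
import Literature.MathematicalPhysics.QuantumFieldTheory.LatticeGaugeProofs
import Literature.MathematicalPhysics.QuantumFieldTheory.StrongCouplingActivities
import Summits.Ventures.LatticeQCDFlow.Scaling.Conjectures
import Summits.Ventures.LatticeQCDFlow.Scaling.ConjecturesRepaired
import Summits.Ventures.LatticeQCDFlow.Scaling.CorrelatorFloorTwoDimU1
import Summits.Ventures.LatticeQCDFlow.Scaling.WilsonPairCovarianceTwoDim

/-!
# LatticeQCDFlow / Scaling — (U′) and (U″) are FALSE in two dimensions for EVERY compact gauge group, every continuous representation and every real coupling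

HONEST FRAMING: exact (Metropolis-corrected) sampling algorithms for lattice gauge theory; figures of merit are
autocorrelation/cost numbers at stated couplings and volumes; no continuum-physics claim.

Venture `LatticeQCDFlow` (cell pub-lqcd), topic `Scaling`, FANOUT row 30 (lean-1) — OUR WORK, the general form of the
two-dimensional refutation (`Scaling/CorrelatorFloorTwoDimU1.lean` did `U(1)`, `β ≥ 0`, via Haar-convolution
flatness; here every compact second-countable `G`, every continuous `ρ : G →* M_N(ℂ)`, every real `β`, via the
one-bad-set expansion `Scaling/PlaquetteDecorrelationTwoDim.lean` → `Scaling/WilsonPairCovarianceTwoDim.lean`):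

* **`wilson_plaquette_pair_decorrelation`** — there is `C_{ρ,β}(L) → 0` such that for every `L ≥ 2`, ALL sites `p ≠ p'`
  of `(ℤ/L)²` and all measurable `φ, ψ : G → ℝ` with `|φ| ≤ A`, `|ψ| ≤ B`:
  `|⟨φ(U_p)ψ(U_{p'})⟩_{β,L} − ⟨φ(U_p)⟩_{β,L}·⟨ψ(U_{p'})⟩_{β,L}| ≤ A·B·C_{ρ,β}(L)` (`⟨·⟩ = wilsonExpectation ρ β`): in two
  dimensions any two plaquettes of the Wilson measure, adjacent or not, are asymptotically independent, uniformly in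
  their positions, for every compact gauge group (the connected correlator is a pure finite-volume effect);
* `exists_plaqObs_eq` — the observable `Re tr ρ(U_x^{(i,j)})` of a genuine plane `i ≠ j` is a
  bounded measurable function of the `(0,1)`-holonomy (`(1,0)` carries the inverse holonomy);
* **`not_crossCutCorrelatorFloor_two`** — `¬ Conjectures.CrossCutCorrelatorFloor 2 N G ρ β R i j a` for EVERY compact
  second-countable `G`, continuous `ρ`, real `β`, cut width `R`, plane `i ≠ j`, axis `a`;
* **`not_clusteringFloor_two`** — `¬ Conjectures.ClusteringFloor 2 N G ρ β i j a` likewise (separation `s = 1` fails);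
* `not_crossCutCorrelatorFloorR_two_unguarded`, `not_clusteringFloorR_two_unguarded` — with every OTHER guard of the
  repaired items (`ConjecturesRepaired`, v2.5) in force (`i ≠ j`, `0 < β`, a non-constant character) the floors still
  fail in `d = 2`: the dimension guard `3 ≤ d` is NECESSARY for every compact gauge group (`SU(N)`, `U(N)`, `U(1)`, …),
  not hygiene; `crossCutCorrelatorFloorR_two_any` — the repaired item itself holds vacuously in `d = 2`.

With `CorrelatorFloorDegenerate.lean` (`i = j`, every `d`) every two-dimensional instance of the two unrepaired items is
now decided: all false.  (`G : Type`, as in the conjecture items.)  NOT CLAIMED: anything in `d ≥ 3` — there (U′)/(U″)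
are theorems at strong coupling (`SUNCrossCutFloor`, `U1CrossCutFloorAllT`, `UNCrossCutFloor`,
`ClusteringFloorStrongCoupling`) and genuine conjectures at intermediate `β`; discontinuous `ρ`.  Literature grade: known
physics (two-dimensional lattice gauge theory is solvable; Migdal 1975, Gross–Witten 1980); new = kernel-checked
refutation of the venture's typed items in `d = 2` for every compact gauge group.  Elementary given the tree; nothing
here is cited as a fact; no `def`, no `sorry`.
-/

noncomputable section

namespace Summit.Ventures.LatticeQCDFlow.Theory2.Lattice.TwoDim

open MeasureTheory Filter Topology Literature.MathematicalPhysics.QuantumFieldTheory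
open scoped ENNReal

variable {L N : ℕ} {G : Type} [Group G] [TopologicalSpace G] [IsTopologicalGroup G] [CompactSpace G]
  [SecondCountableTopology G] [MeasurableSpace G] [BorelSpace G] (ρ : G →* Matrix (Fin N) (Fin N) ℂ)

/-! ## §4. Signed observables; the packaged decorrelation law -/

/-- **UNIFORM DECORRELATION OF PLAQUETTE PAIRS, EVERY COMPACT GAUGE GROUP** (2-d, continuous `ρ`, any real `β`):
there is `C_{ρ,β}(L) → 0` with `|⟨φ(U_p)ψ(U_{p'})⟩_{β,L} − ⟨φ(U_p)⟩_{β,L}⟨ψ(U_{p'})⟩_{β,L}| ≤ A·B·C_{ρ,β}(L)` for every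
`L ≥ 2`, ALL sites `p ≠ p'` of `(ℤ/L)²` and all measurable `|φ| ≤ A`, `|ψ| ≤ B` (`⟨·⟩ = wilsonExpectation ρ β`). [folklore] -/
theorem wilson_plaquette_pair_decorrelation (hρ : Continuous ρ) (β : ℝ) :
    ∃ C : ℕ → ℝ, Tendsto C atTop (𝓝 0) ∧
      ∀ (L : ℕ) [NeZero L], 2 ≤ L → ∀ p p' : Site 2 L, p ≠ p' →
        ∀ φ ψ : G → ℝ, Measurable φ → Measurable ψ → ∀ A B : ℝ,
          (∀ g, |φ g| ≤ A) → (∀ g, |ψ g| ≤ B) →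
          |wilsonExpectation (d := 2) (L := L) ρ β
                (fun U => φ (plaquetteHolonomy U p 0 1) * ψ (plaquetteHolonomy U p' 0 1)) -
            wilsonExpectation (d := 2) (L := L) ρ β (fun U => φ (plaquetteHolonomy U p 0 1)) *
              wilsonExpectation (d := 2) (L := L) ρ β (fun U => ψ (plaquetteHolonomy U p' 0 1))| ≤
            A * B * C L := by
  obtain ⟨r, -, hr1, hsand⟩ := wilson_abs_cov_pair_nonneg ρ hρ β
  refine ⟨fun L => 4 * ((r L)⁻¹ ^ 2 - r L), ?_, fun L _ hL p p' hpp' φ ψ hφm hψm A B hφA hψB => ?_⟩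
  · have h := (((hr1.inv₀ one_ne_zero).pow 2).sub hr1).const_mul 4
    simpa using h
  unfold wilsonExpectation
  set μ := wilsonMeasure (d := 2) (L := L) ρ β with hμ
  haveI : IsProbabilityMeasure μ := isProbabilityMeasure_wilsonMeasure (d := 2) (L := L) ρ hρ β
  have hA0 : 0 ≤ A := (abs_nonneg _).trans (hφA 1)
  have hB0 : 0 ≤ B := (abs_nonneg _).trans (hψB 1)
  have hmp : ∀ q : Site 2 L, Measurable fun U : GaugeConfig 2 L G => plaquetteHolonomy U q 0 1 :=
    fun q => measurable_plaquetteHolonomy q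
  -- shifted, non-negative observables
  have key := hsand L hL p p' hpp' (fun g => φ g + A) (fun g => ψ g + B) (hφm.add_const A) (hψm.add_const B)
    (2 * A) (2 * B)
    (fun g => by linarith [neg_abs_le (φ g), hφA g]) (fun g => by linarith [le_abs_self (φ g), hφA g])
    (fun g => by linarith [neg_abs_le (ψ g), hψB g]) (fun g => by linarith [le_abs_self (ψ g), hψB g])
  set F : GaugeConfig 2 L G → ℝ := fun U => φ (plaquetteHolonomy U p 0 1) with hF
  set G' : GaugeConfig 2 L G → ℝ := fun U => ψ (plaquetteHolonomy U p' 0 1) with hG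
  have hFm : Measurable F := hφm.comp (hmp p)
  have hGm : Measurable G' := hψm.comp (hmp p')
  have hFi : Integrable F μ := Integrable.of_bound hFm.aestronglyMeasurable A
    (ae_of_all _ fun U => by rw [Real.norm_eq_abs]; exact hφA _)
  have hGi : Integrable G' μ := Integrable.of_bound hGm.aestronglyMeasurable B
    (ae_of_all _ fun U => by rw [Real.norm_eq_abs]; exact hψB _)
  have hFGi : Integrable (fun U => F U * G' U) μ := Integrable.of_bound (hFm.mul hGm).aestronglyMeasurable (A * B)
    (ae_of_all _ fun U => by
      rw [Real.norm_eq_abs, abs_mul]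
      exact mul_le_mul (hφA _) (hψB _) (abs_nonneg _) hA0)
  have hXe : ∫ U, (φ (plaquetteHolonomy U p 0 1) + A) * (ψ (plaquetteHolonomy U p' 0 1) + B) ∂μ =
      ∫ U, F U * G' U ∂μ + B * ∫ U, F U ∂μ + A * ∫ U, G' U ∂μ + A * B := by
    have h1 : (fun U => (φ (plaquetteHolonomy U p 0 1) + A) * (ψ (plaquetteHolonomy U p' 0 1) + B)) =
        fun U => F U * G' U + B * F U + A * G' U + A * B := by
      funext U; simp only [hF, hG]; ring
    have i1 : Integrable (fun U => F U * G' U + B * F U) μ := hFGi.add (hFi.const_mul B)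
    have i2 : Integrable (fun U => F U * G' U + B * F U + A * G' U) μ := i1.add (hGi.const_mul A)
    rw [h1, integral_add i2 (integrable_const _), integral_add i1 (hGi.const_mul A),
      integral_add hFGi (hFi.const_mul B), integral_const_mul, integral_const_mul, integral_const]
    simp
  have hYe : ∫ U, (φ (plaquetteHolonomy U p 0 1) + A) ∂μ = ∫ U, F U ∂μ + A := by
    rw [integral_add hFi (integrable_const _), integral_const]; simp
  have hZe : ∫ U, (ψ (plaquetteHolonomy U p' 0 1) + B) ∂μ = ∫ U, G' U ∂μ + B := by
    rw [integral_add hGi (integrable_const _), integral_const]; simp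
  rw [hXe, hYe, hZe] at key
  have hcov : ∫ U, F U * G' U ∂μ + B * ∫ U, F U ∂μ + A * ∫ U, G' U ∂μ + A * B -
      (∫ U, F U ∂μ + A) * (∫ U, G' U ∂μ + B) = ∫ U, F U * G' U ∂μ - (∫ U, F U ∂μ) * ∫ U, G' U ∂μ := by ring
  rw [hcov] at key
  calc _ ≤ _ := key
    _ = _ := by ring

/-! ## §5. (U′) and (U″) fail in two dimensions, every compact gauge group -/

omit [SecondCountableTopology G] in
/-- **The plaquette observable of a genuine plane is a bounded measurable function of the `(0,1)`-holonomy**: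
`Re tr ρ(U_x^{(i,j)}) = φ(U_x^{(0,1)})` with `φ = Re tr ρ` (`(i,j) = (0,1)`) or `φ = Re tr ρ(·⁻¹)` (`(1,0)`). [folklore] -/
theorem exists_plaqObs_eq (hρ : Continuous ρ) {i j : Fin 2} (hij : i ≠ j) :
    ∃ φ : G → ℝ, Measurable φ ∧ (∃ Mφ : ℝ, ∀ g, |φ g| ≤ Mφ) ∧
      ∀ (L : ℕ) (U : GaugeConfig 2 L G) (x : Site 2 L),
        (ρ (plaquetteHolonomy U x i j)).trace.re = φ (plaquetteHolonomy U x 0 1) := by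
  obtain ⟨M, -, hM⟩ := exists_bound_trace_re_nonneg ρ hρ
  have hinv : ∀ (L : ℕ) (U : GaugeConfig 2 L G) (x : Site 2 L),
      plaquetteHolonomy U x 1 0 = (plaquetteHolonomy U x 0 1)⁻¹ := fun L U x => by
    unfold plaquetteHolonomy; group
  fin_cases i <;> fin_cases j
  · exact absurd rfl hij
  · exact ⟨fun g => (ρ g).trace.re, (continuous_trace_re ρ hρ).measurable, ⟨M, hM⟩, fun L U x => rfl⟩
  · refine ⟨fun g => (ρ g⁻¹).trace.re, ((continuous_trace_re ρ hρ).comp continuous_inv).measurable,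
      ⟨M, fun g => hM g⁻¹⟩, fun L U x => ?_⟩
    show (ρ (plaquetteHolonomy U x 1 0)).trace.re = (ρ (plaquetteHolonomy U x 0 1)⁻¹).trace.re
    rw [hinv]
  · exact absurd rfl hij

/-- **(U′) IS FALSE IN TWO DIMENSIONS** for every compact second-countable gauge group `G`, every continuous
representation `ρ`, every real `β`, every cut width `R`, every plane `i ≠ j` and every axis `a`:
`¬ CrossCutCorrelatorFloor 2 N G ρ β R i j a`. [folklore] -/
theorem not_crossCutCorrelatorFloor_two (hρ : Continuous ρ) (β : ℝ) (R : ℕ) {i j : Fin 2} (hij : i ≠ j)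
    (a : Fin 2) : ¬ Conjectures.CrossCutCorrelatorFloor 2 N G ρ β R i j a := by
  obtain ⟨φ, hφm, ⟨Mφ, hφM⟩, hφ⟩ := exists_plaqObs_eq ρ hρ hij
  obtain ⟨C, hC, hcov⟩ := wilson_plaquette_pair_decorrelation ρ hρ β
  rintro ⟨δ, hδ, L₀, h⟩
  have hev : ∀ᶠ L : ℕ in atTop, Mφ * Mφ * C L < δ := by
    have ht : Tendsto (fun L => Mφ * Mφ * C L) atTop (𝓝 (Mφ * Mφ * 0)) := hC.const_mul _
    rw [mul_zero] at ht
    exact ht.eventually (gt_mem_nhds hδ)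
  obtain ⟨L, hLt, hLge⟩ := (hev.and (eventually_ge_atTop (max L₀ (max 2 (2 * R + 2))))).exists
  have hL0 : L₀ ≤ L := le_trans (le_max_left _ _) hLge
  have hL2 : 2 ≤ L := le_trans (le_trans (le_max_left _ _) (le_max_right _ _)) hLge
  have hLR : 2 * R + 2 ≤ L := le_trans (le_trans (le_max_right _ _) (le_max_right _ _)) hLge
  haveI : NeZero L := ⟨by omega⟩
  set x : Site 2 L := 0
  have hxx' : x ≠ x + Pi.single a (((2 * R + 1 : ℕ)) : ZMod L) := ne_add_single x a (by omega) (by omega)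
  have hδle := h L hL0 x
  simp only [hφ] at hδle
  have hc := hcov L hL2 x _ hxx' φ φ hφm hφm Mφ Mφ hφM hφM
  exact absurd (lt_of_le_of_lt (hδle.trans hc) hLt) (lt_irrefl _)

/-- **(U″) IS FALSE IN TWO DIMENSIONS** for every compact second-countable `G`, continuous `ρ`, real `β`,
plane `i ≠ j`, axis `a`: `¬ ClusteringFloor 2 N G ρ β i j a` (already the separation `s = 1` fails). [folklore] -/
theorem not_clusteringFloor_two (hρ : Continuous ρ) (β : ℝ) {i j : Fin 2} (hij : i ≠ j) (a : Fin 2) :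
    ¬ Conjectures.ClusteringFloor 2 N G ρ β i j a := by
  obtain ⟨φ, hφm, ⟨Mφ, hφM⟩, hφ⟩ := exists_plaqObs_eq ρ hρ hij
  obtain ⟨C, hC, hcov⟩ := wilson_plaquette_pair_decorrelation ρ hρ β
  rintro ⟨κ₀, hκ₀, ξ, hξ, L₀, h⟩
  have hδ : 0 < κ₀ * Real.exp (-(((1 : ℕ) : ℝ) / ξ)) := mul_pos hκ₀ (Real.exp_pos _)
  have hev : ∀ᶠ L : ℕ in atTop, Mφ * Mφ * C L < κ₀ * Real.exp (-(((1 : ℕ) : ℝ) / ξ)) := by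
    have ht : Tendsto (fun L => Mφ * Mφ * C L) atTop (𝓝 (Mφ * Mφ * 0)) := hC.const_mul _
    rw [mul_zero] at ht
    exact ht.eventually (gt_mem_nhds hδ)
  obtain ⟨L, hLt, hLge⟩ := (hev.and (eventually_ge_atTop (max L₀ 4))).exists
  have hL0 : L₀ ≤ L := le_trans (le_max_left _ _) hLge
  have hL4 : 4 ≤ L := le_trans (le_max_right _ _) hLge
  haveI : NeZero L := ⟨by omega⟩
  set x : Site 2 L := 0
  have hxx' : x ≠ x + Pi.single a (((1 : ℕ)) : ZMod L) := ne_add_single x a (by omega) (by omega)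
  have hδle := h L hL0 1 (by omega) x
  simp only [hφ] at hδle
  have hc := hcov L (by omega) x _ hxx' φ φ hφm hφm Mφ Mφ hφM hφM
  exact absurd (lt_of_le_of_lt (hδle.trans hc) hLt) (lt_irrefl _)

/-- **THE DIMENSION GUARD OF THE REPAIRED ITEM IS NECESSARY, every compact gauge group**: with every OTHER guard of
`ConjecturesRepaired.CrossCutCorrelatorFloorR` in force (`i ≠ j`, `0 < β`, a non-constant character) the cross-cut
floor still fails in `d = 2`. [folklore] -/
theorem not_crossCutCorrelatorFloorR_two_unguarded (hρ : Continuous ρ) {β : ℝ} (hβ : 0 < β) (R : ℕ)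
    {i j : Fin 2} (hij : i ≠ j) (a : Fin 2) (hnc : ∃ g : G, (ρ g).trace.re ≠ N) :
    ¬ (i ≠ j → 0 < β → (∃ g : G, (ρ g).trace.re ≠ N) →
        Conjectures.CrossCutCorrelatorFloor 2 N G ρ β R i j a) :=
  fun h => not_crossCutCorrelatorFloor_two ρ hρ β R hij a (h hij hβ hnc)

/-- The same for the clustering floor: dropping only `3 ≤ d` from `ConjecturesRepaired.ClusteringFloorR` gives a
FALSE statement in `d = 2`, for every compact gauge group with a non-constant character. [folklore] -/
theorem not_clusteringFloorR_two_unguarded (hρ : Continuous ρ) {β : ℝ} (hβ : 0 < β) {i j : Fin 2}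
    (hij : i ≠ j) (a : Fin 2) (hnc : ∃ g : G, (ρ g).trace.re ≠ N) :
    ¬ (i ≠ j → 0 < β → (∃ g : G, (ρ g).trace.re ≠ N) → Conjectures.ClusteringFloor 2 N G ρ β i j a) :=
  fun h => not_clusteringFloor_two ρ hρ β hij a (h hij hβ hnc)

omit [SecondCountableTopology G] in
/-- By contrast the repaired items hold (vacuously) in `d = 2`: the guard `3 ≤ d` is exactly what separates them
from the false unguarded statements above. [folklore] -/
theorem crossCutCorrelatorFloorR_two_any (β : ℝ) (R : ℕ) (i j a : Fin 2) :
    Conjectures.CrossCutCorrelatorFloorR 2 N G ρ β R i j a :=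
  fun hd => absurd hd (by norm_num)

end Summit.Ventures.LatticeQCDFlow.Theory2.Lattice.TwoDim

end
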